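import Summits.AtomisticToContinuum.Crystallization.Theorems.ChartedPlanarOrderPlanesDomination

/-!
# Slot 7b by the method of planes, module P3a′: far grid images, point sums over separated sets, kernel bounds (decomp-a2c lens-3 g26)

Continuation of `…ChartedPlanarOrderPlanesDomination` (split for the 400-line rule):

* §3 far points have far grid images: `‖x − y‖ ≥ R ≥ M δ`, `M ≥ 1` ⇒ some coordinate of `grid δ y − grid δ x` has modulus `≥ M`;
  rotated frame `e`: if moreover `|⟪e 0, x − y⟫| ≤ R/2`, one of the two PLANAR coordinates of `gridE δ e y − gridE δ e x` is `≥ M`;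
* §4 ★ POINT SUMS: for `x ∈ S`, `S` `δ`-separated, `s ⊆ S ∖ {x}` finite with all points at distance `≥ R ≥ M δ` from `x`:
  `∑_{y ∈ s} ‖x − y‖⁻⁶ ≤ (4/δ)⁶ · 192/(M+1)` (`M = 0`: the unconditional bound; tail form `≤ 192 (4/δ)⁶ (2δ/R)` for `R ≥ 2δ`);
* §5 kernel bounds for `‖Δ‖ ≥ δ`: `|(‖Δ‖⁻¹⁴ − ‖Δ‖⁻⁸)⟪u,Δ⟫⟪v,Δ⟫| ≤ (δ⁻⁶+1)‖u‖‖v‖‖Δ‖⁻⁶` (virial kernel) and `‖pairForce Δ‖ ≤ (δ⁻⁶+1)δ⁻¹‖Δ‖⁻⁶`.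

Mathlib only (+ the lens-3 modules imported); `[folklore]`; no instances, no notation, sorry-free.
-/

noncomputable section

open MeasureTheory Set Metric Filter Topology
open scoped RealInnerProductSpace
open Summit.AtomisticToContinuum.Crystallization.Theorems.ChartedPlanarOrderRigidityDoor
open Summit.AtomisticToContinuum.Crystallization.Theorems.ChartedPlanarOrderDensityDichotomy
open Summit.AtomisticToContinuum.Crystallization.Theorems.ChartedPlanarOrderMesoCut
open Summit.AtomisticToContinuum.Crystallization.Theorems.ChartedPlanarOrderProfileSlavingLJ (pairForce layerForce IsStacked)
open Summit.AtomisticToContinuum.Crystallization.Theorems.ChartedPlanarOrderDoorLayered (Layered)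
open Summit.AtomisticToContinuum.Crystallization.Theorems.ChartedPlanarOrderNashForceBalance
open Summit.AtomisticToContinuum.Crystallization.Theorems.ChartedPlanarOrderSepCounting (gridE gridE_fst norm_sq_eq_sum_inner)
open Summit.AtomisticToContinuum.Crystallization.Theorems.ChartedPlanarOrderPlanesDomination

namespace Summit.AtomisticToContinuum.Crystallization.Theorems.ChartedPlanarOrderPlanesPointSums

/-! ## 3. Far points have far grid images -/

section Far

variable {δ : ℝ}

/-- integer parts at scale `δ/2` of two reals at distance `≥ M δ / 2` differ by `≥ M`. -/
theorem le_abs_floor_sub_floor (hδ : 0 < δ) {a b : ℝ} {M : ℕ} (h : (M : ℝ) * δ ≤ 2 * |a - b|) :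
    (M : ℤ) ≤ |⌊2 / δ * a⌋ - ⌊2 / δ * b⌋| := by
  have hc : (0 : ℝ) < 2 / δ := by positivity
  have h1 : (M : ℝ) ≤ 2 / δ * |a - b| := by
    rw [show 2 / δ * |a - b| = (2 * |a - b|) / δ by ring]
    exact (le_div_iff₀ hδ).mpr h
  have key : (2 / δ * |a - b| : ℝ) - 1 < |((⌊2 / δ * a⌋ - ⌊2 / δ * b⌋ : ℤ) : ℝ)| := by
    have e : 2 / δ * |a - b| = |2 / δ * a - 2 / δ * b| := by rw [← mul_sub, abs_mul, abs_of_pos hc]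
    rw [e]
    have h1 := Int.floor_le (2 / δ * a)
    have h2 := Int.lt_floor_add_one (2 / δ * a)
    have h3 := Int.floor_le (2 / δ * b)
    have h4 := Int.lt_floor_add_one (2 / δ * b)
    rw [Int.cast_sub]
    rcases le_or_gt 0 (2 / δ * a - 2 / δ * b) with hab | hab
    · rw [abs_of_nonneg hab]
      exact lt_of_lt_of_le (by linarith) (le_abs_self _)
    · rw [abs_of_neg hab]
      exact lt_of_lt_of_le (by linarith) (neg_le_abs _)
  have h2 : ((M : ℤ) : ℝ) - 1 < |((⌊2 / δ * a⌋ - ⌊2 / δ * b⌋ : ℤ) : ℝ)| := by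
    have e : ((M : ℤ) : ℝ) = (M : ℝ) := Int.cast_natCast M
    rw [e]
    linarith
  have h3 : (M : ℤ) - 1 < |⌊2 / δ * a⌋ - ⌊2 / δ * b⌋| := by exact_mod_cast h2
  exact Int.sub_one_lt_iff.mp h3

/-- ★ two points at distance `≥ R ≥ M δ` (`M ≥ 1`) have grid images differing by `≥ M` in some coordinate. -/
theorem exists_coord_far (hδ : 0 < δ) {x y : E3} {R : ℝ} {M : ℕ} (hM : 1 ≤ M) (hMR : (M : ℝ) * δ ≤ R)
    (hxy : R ≤ ‖x - y‖) :
    (M : ℤ) ≤ |(grid δ y).1 - (grid δ x).1| ∨ (M : ℤ) ≤ |(grid δ y).2.1 - (grid δ x).2.1| ∨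
      (M : ℤ) ≤ |(grid δ y).2.2 - (grid δ x).2.2| := by
  have hM' : (1 : ℝ) ≤ M := by exact_mod_cast hM
  have hR : 0 < R := lt_of_lt_of_le (by nlinarith) hMR
  have key : ∀ {a b : ℝ}, R / 2 ≤ |a - b| → (M : ℤ) ≤ |⌊2 / δ * a⌋ - ⌊2 / δ * b⌋| :=
    fun h => le_abs_floor_sub_floor hδ (by linarith)
  by_cases h0 : R / 2 ≤ |y.ofLp 0 - x.ofLp 0|
  · exact Or.inl (key h0)
  by_cases h1 : R / 2 ≤ |y.ofLp 1 - x.ofLp 1|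
  · exact Or.inr (Or.inl (key h1))
  by_cases h2 : R / 2 ≤ |y.ofLp 2 - x.ofLp 2|
  · exact Or.inr (Or.inr (key h2))
  exfalso
  replace h0 := not_le.mp h0
  replace h1 := not_le.mp h1
  replace h2 := not_le.mp h2
  have hsq : ‖x - y‖ ^ 2 = (x.ofLp 0 - y.ofLp 0) ^ 2 + (x.ofLp 1 - y.ofLp 1) ^ 2 + (x.ofLp 2 - y.ofLp 2) ^ 2 := by
    rw [norm_sq_eq_sum]; rfl
  have a0 : (x.ofLp 0 - y.ofLp 0) ^ 2 < (R / 2) ^ 2 := by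
    have := sq_lt_sq' (abs_lt.mp h0).1 (abs_lt.mp h0).2; nlinarith
  have a1 : (x.ofLp 1 - y.ofLp 1) ^ 2 < (R / 2) ^ 2 := by
    have := sq_lt_sq' (abs_lt.mp h1).1 (abs_lt.mp h1).2; nlinarith
  have a2 : (x.ofLp 2 - y.ofLp 2) ^ 2 < (R / 2) ^ 2 := by
    have := sq_lt_sq' (abs_lt.mp h2).1 (abs_lt.mp h2).2; nlinarith
  have hR2 : R ^ 2 ≤ ‖x - y‖ ^ 2 := pow_le_pow_left₀ hR.le hxy 2
  nlinarith

/-- ★ ROTATED FRAME: two points at distance `≥ R ≥ M δ` (`M ≥ 1`) whose separation along `e 0` is `≤ R/2` have grid images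
(`gridE δ e`) differing by `≥ M` in one of the two planar coordinates. -/
theorem exists_planar_coord_far (hδ : 0 < δ) (e : OrthonormalBasis (Fin 3) ℝ E3) {x y : E3} {R : ℝ} {M : ℕ} (hM : 1 ≤ M)
    (hMR : (M : ℝ) * δ ≤ R) (hxy : R ≤ ‖x - y‖) (hn : |⟪e 0, x - y⟫| ≤ R / 2) :
    (M : ℤ) ≤ |(gridE δ e y).2.1 -
        (gridE δ e x).2.1| ∨
      (M : ℤ) ≤ |(gridE δ e y).2.2 -
        (gridE δ e x).2.2| := by
  have hM' : (1 : ℝ) ≤ M := by exact_mod_cast hM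
  have hR : 0 < R := lt_of_lt_of_le (by nlinarith) hMR
  have key : ∀ {a b : ℝ}, R / 2 ≤ |a - b| → (M : ℤ) ≤ |⌊2 / δ * a⌋ - ⌊2 / δ * b⌋| :=
    fun h => le_abs_floor_sub_floor hδ (by linarith)
  have hsplit : ∀ i : Fin 3, ⟪e i, x - y⟫ = ⟪e i, x⟫ - ⟪e i, y⟫ := fun i => inner_sub_right _ _ _
  by_cases h1 : R / 2 ≤ |⟪e 1, y⟫ - ⟪e 1, x⟫|
  · exact Or.inl (key h1)
  by_cases h2 : R / 2 ≤ |⟪e 2, y⟫ - ⟪e 2, x⟫|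
  · exact Or.inr (key h2)
  exfalso
  replace h1 := not_le.mp h1
  replace h2 := not_le.mp h2
  have hsq := norm_sq_eq_sum_inner e (x - y)
  rw [hsplit 0, hsplit 1, hsplit 2] at hsq
  rw [hsplit 0] at hn
  have a0 : (⟪e 0, x⟫ - ⟪e 0, y⟫) ^ 2 ≤ (R / 2) ^ 2 := by
    have := abs_le.mp hn; nlinarith
  have a1 : (⟪e 1, x⟫ - ⟪e 1, y⟫) ^ 2 < (R / 2) ^ 2 := by
    rw [abs_sub_comm] at h1
    have := sq_lt_sq' (abs_lt.mp h1).1 (abs_lt.mp h1).2; nlinarith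
  have a2 : (⟪e 2, x⟫ - ⟪e 2, y⟫) ^ 2 < (R / 2) ^ 2 := by
    rw [abs_sub_comm] at h2
    have := sq_lt_sq' (abs_lt.mp h2).1 (abs_lt.mp h2).2; nlinarith
  have hR2 : R ^ 2 ≤ ‖x - y‖ ^ 2 := pow_le_pow_left₀ hR.le hxy 2
  nlinarith

end Far

/-! ## 4. Point sums of `‖x − y‖⁻⁶` over a separated set -/

section PointSums

variable {δ : ℝ} {S : Set E3}

/-- ★ POINT SUMS: `∑_{y ∈ s} ‖x − y‖⁻⁶ ≤ (4/δ)⁶ · 192/(M+1)` for a finite `s ⊆ S ∖ {x}` whose points lie at distance `≥ R ≥ M δ`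
from `x ∈ S` (`M = 0`, `R = 0`: the unconditional local bound; `M ≥ 1`: the tail bound). -/
theorem sum_inv_pow_six_le (hδ : 0 < δ) (hS : IsSep δ S) {x : E3} (hx : x ∈ S) (s : Finset E3)
    (hs : ∀ y ∈ s, y ∈ S ∧ y ≠ x) {R : ℝ} {M : ℕ} (hMR : (M : ℝ) * δ ≤ R) (hfar : ∀ y ∈ s, R ≤ ‖x - y‖) :
    ∑ y ∈ s, (‖x - y‖⁻¹) ^ 6 ≤ (4 / δ) ^ 6 * (192 / ((M : ℝ) + 1)) := by
  classical
  have hsep : ∀ y ∈ s, δ ≤ ‖x - y‖ := fun y hy => by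
    rw [← dist_eq_norm]; exact hS x hx y (hs y hy).1 (hs y hy).2.symm
  calc ∑ y ∈ s, (‖x - y‖⁻¹) ^ 6 ≤ ∑ y ∈ s, (4 / δ) ^ 6 * vWeight (grid δ x) (grid δ y) :=
        Finset.sum_le_sum fun y hy => inv_pow_six_le_vWeight hδ (hsep y hy)
    _ = (4 / δ) ^ 6 * ∑ k ∈ s.image (grid δ), vWeight (grid δ x) k := by
        rw [← Finset.mul_sum, Finset.sum_image]
        exact fun y hy y' hy' h => grid_injOn hδ hS (hs y hy).1 (hs y' hy').1 h
    _ ≤ (4 / δ) ^ 6 * (192 / ((M : ℝ) + 1)) := by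
        refine mul_le_mul_of_nonneg_left (sum_vWeight_le _ _ M fun k hk => ?_) (by positivity)
        obtain ⟨y, hy, rfl⟩ := Finset.mem_image.mp hk
        rcases Nat.eq_zero_or_pos M with rfl | hM
        · left; simp
        · exact exists_coord_far hδ hM hMR (hfar y hy)

/-- the unconditional point sum: `∑_{y ∈ s} ‖x − y‖⁻⁶ ≤ 192 (4/δ)⁶`. -/
theorem sum_inv_pow_six_le_local (hδ : 0 < δ) (hS : IsSep δ S) {x : E3} (hx : x ∈ S) (s : Finset E3)
    (hs : ∀ y ∈ s, y ∈ S ∧ y ≠ x) : ∑ y ∈ s, (‖x - y‖⁻¹) ^ 6 ≤ (4 / δ) ^ 6 * 192 := by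
  have h := sum_inv_pow_six_le hδ hS hx s hs (R := 0) (M := 0) (by simp) fun y _ => norm_nonneg _
  exact h.trans (le_of_eq (by norm_num))

/-- the tail point sum at range `R ≥ 2δ`: `∑_{y ∈ s, ‖x−y‖ ≥ R} ‖x − y‖⁻⁶ ≤ 192 (4/δ)⁶ · (2δ/R)` (with `M = ⌊R/δ⌋ ≥ R/δ − 1 ≥ R/(2δ)`). -/
theorem sum_inv_pow_six_le_tail (hδ : 0 < δ) (hS : IsSep δ S) {x : E3} (hx : x ∈ S) (s : Finset E3)
    (hs : ∀ y ∈ s, y ∈ S ∧ y ≠ x) {R : ℝ} (hR : 2 * δ ≤ R) (hfar : ∀ y ∈ s, R ≤ ‖x - y‖) :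
    ∑ y ∈ s, (‖x - y‖⁻¹) ^ 6 ≤ (4 / δ) ^ 6 * 192 * (2 * δ / R) := by
  have hR0 : 0 < R := lt_of_lt_of_le (by positivity) hR
  set M := ⌊R / δ⌋₊ with hM
  have hMR : (M : ℝ) * δ ≤ R := by
    have h1 : (M : ℝ) ≤ R / δ := Nat.floor_le (by positivity)
    calc (M : ℝ) * δ ≤ R / δ * δ := mul_le_mul_of_nonneg_right h1 hδ.le
      _ = R := div_mul_cancel₀ R hδ.ne'
  have hM1 : R / δ ≤ (M : ℝ) + 1 := (Nat.lt_floor_add_one (R / δ)).le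
  have h := sum_inv_pow_six_le hδ hS hx s hs hMR hfar
  refine h.trans ?_
  rw [mul_assoc]
  refine mul_le_mul_of_nonneg_left ?_ (by positivity)
  -- 192/(M+1) ≤ 192 · 2δ/R  ⟸  R ≤ 2δ(M+1)  ⟸  R/δ ≤ M+1 ≤ 2(M+1)... precisely R = δ (R/δ) ≤ δ (M+1) ≤ 2 δ (M+1)
  have hM1' : R ≤ δ * ((M : ℝ) + 1) := by
    have := mul_le_mul_of_nonneg_left hM1 hδ.le
    rwa [mul_div_cancel₀ R hδ.ne'] at this
  rw [div_le_iff₀ (by positivity : (0 : ℝ) < (M : ℝ) + 1), show (192 : ℝ) * (2 * δ / R) * ((M : ℝ) + 1)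
    = 192 * (2 * (δ * ((M : ℝ) + 1))) / R by ring, le_div_iff₀ hR0]
  nlinarith

end PointSums

/-! ## 5. Kernel bounds for `‖Δ‖ ≥ δ` -/

section Kernel

variable {δ : ℝ}

/-- the virial kernel of one pair: `|(‖Δ‖⁻¹⁴ − ‖Δ‖⁻⁸) ⟪u, Δ⟫ ⟪v, Δ⟫| ≤ (δ⁻⁶ + 1) ‖u‖ ‖v‖ ‖Δ‖⁻⁶`. -/
theorem abs_kernel_le (hδ : 0 < δ) {Δ : E3} (u v : E3) (hΔ : δ ≤ ‖Δ‖) :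
    |((‖Δ‖⁻¹) ^ 14 - (‖Δ‖⁻¹) ^ 8) * (⟪u, Δ⟫ * ⟪v, Δ⟫)| ≤ ((δ⁻¹) ^ 6 + 1) * (‖u‖ * ‖v‖) * (‖Δ‖⁻¹) ^ 6 := by
  have hr : 0 < ‖Δ‖ := lt_of_lt_of_le hδ hΔ
  set ρ := ‖Δ‖⁻¹ with hρ
  have hρ0 : 0 < ρ := inv_pos.mpr hr
  have hρδ : ρ ≤ δ⁻¹ := (inv_le_inv₀ hr hδ).mpr hΔ
  have hρr : ρ * ‖Δ‖ = 1 := inv_mul_cancel₀ hr.ne'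
  have huΔ : |⟪u, Δ⟫| ≤ ‖u‖ * ‖Δ‖ := abs_real_inner_le_norm u Δ
  have hvΔ : |⟪v, Δ⟫| ≤ ‖v‖ * ‖Δ‖ := abs_real_inner_le_norm v Δ
  have h14 := pow_nonneg hρ0.le 14
  have h8 := pow_nonneg hρ0.le 8
  have h1 : |ρ ^ 14 - ρ ^ 8| ≤ ρ ^ 14 + ρ ^ 8 := by
    rw [abs_le]; constructor <;> linarith
  rw [abs_mul, abs_mul]
  calc |ρ ^ 14 - ρ ^ 8| * (|⟪u, Δ⟫| * |⟪v, Δ⟫|) ≤ (ρ ^ 14 + ρ ^ 8) * ((‖u‖ * ‖Δ‖) * (‖v‖ * ‖Δ‖)) :=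
        mul_le_mul h1 (mul_le_mul huΔ hvΔ (abs_nonneg _) (by positivity)) (by positivity) (by positivity)
    _ = (ρ ^ 6 * (ρ * ‖Δ‖) ^ 2 + (ρ * ‖Δ‖) ^ 2) * (‖u‖ * ‖v‖) * ρ ^ 6 := by ring
    _ = (ρ ^ 6 + 1) * (‖u‖ * ‖v‖) * ρ ^ 6 := by rw [hρr]; ring
    _ ≤ ((δ⁻¹) ^ 6 + 1) * (‖u‖ * ‖v‖) * ρ ^ 6 := by
        have h6 : ρ ^ 6 ≤ (δ⁻¹) ^ 6 := pow_le_pow_left₀ hρ0.le hρδ 6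
        have h0 : 0 ≤ (‖u‖ * ‖v‖) * ρ ^ 6 := by positivity
        nlinarith

/-- the pair force beyond distance `δ`: `‖pairForce Δ‖ ≤ (δ⁻⁶ + 1) δ⁻¹ ‖Δ‖⁻⁶`. -/
theorem norm_pairForce_le_inv_pow_six (hδ : 0 < δ) {Δ : E3} (hΔ : δ ≤ ‖Δ‖) :
    ‖pairForce Δ‖ ≤ ((δ⁻¹) ^ 6 + 1) * δ⁻¹ * (‖Δ‖⁻¹) ^ 6 := by
  have hr : 0 < ‖Δ‖ := lt_of_lt_of_le hδ hΔ
  have hne : Δ ≠ 0 := norm_pos_iff.mp hr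
  have h := norm_pairForce_le (x := Δ) (q := 0) (by simpa using hne)
  rw [sub_zero] at h
  set ρ := ‖Δ‖⁻¹ with hρ
  have hρ0 : 0 < ρ := inv_pos.mpr hr
  have hρδ : ρ ≤ δ⁻¹ := (inv_le_inv₀ hr hδ).mpr hΔ
  calc ‖pairForce Δ‖ ≤ ρ ^ 13 + ρ ^ 7 := h
    _ = (ρ ^ 6 + 1) * ρ * ρ ^ 6 := by ring
    _ ≤ ((δ⁻¹) ^ 6 + 1) * δ⁻¹ * ρ ^ 6 := by
        have h6 : ρ ^ 6 ≤ (δ⁻¹) ^ 6 := pow_le_pow_left₀ hρ0.le hρδ 6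
        have h7 : (ρ ^ 6 + 1) * ρ ≤ ((δ⁻¹) ^ 6 + 1) * δ⁻¹ := mul_le_mul (by linarith) hρδ hρ0.le (by positivity)
        exact mul_le_mul_of_nonneg_right h7 (by positivity)

end Kernel

end Summit.AtomisticToContinuum.Crystallization.Theorems.ChartedPlanarOrderPlanesPointSums
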